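import Literature.Analysis.FluidPDE.KNSSTypeIRateMild
import Literature.Analysis.FluidPDE.KNSSTypeIRateCoreProofs
import Literature.Analysis.FluidPDE.SelfSimilarProofs
import Literature.Analysis.FluidPDE.OseenKernelScaling
import Literature.Analysis.UnboundedOperators.HeatKernelBoundedData
import HarnessLib

/-!
# KNSS 2009, Theorem 6.2: the main step from the mildness clause and Steps 5–6 over mild data
# (scaling covariance of the Oseen equation, Steps 2–4 re-threaded, the glue; all proved)

Analysis/FluidPDE proof file for the third layer (`KNSSTypeIRateMild`) of the decomposition of
`Literature.Analysis.FluidPDE.KNSS2009_typeI_rate_rMulNorm_bounded` (Koch–Nadirashvili–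
Seregin–Šverák, Acta Math. 203 (2009) = arXiv:0709.3599, Theorem 6.2, main step). It proves:

* **Parabolic covariance of the Oseen integral equation** (KNSS §1, (1.2): "the scaling symmetry
  `u(x,t) → λu(λx, λ²t)` of the equations"; for the integral equation: the kernel `K` of §3 is
  homogeneous, `K(λ²τ, λz) = λ^{−n−1}K(τ, z)` — the tree's `oseenKernel_sq_mul_smul`,
  `OseenKernelScaling.lean`): for the
  zoomed field `w(s, y) = c u(t₀ + c²s, x₀ + cy)` (`c • stPull (c²) c t₀ x₀ u` of
  `ClassicalSolutionRescale`), `e^{TΔ}w(σ) = c (e^{c²TΔ}u(t₀+c²σ))(x₀ + c·)`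
  (`heatExtension_smul_stPull`) and `B¹_σ(w,w)(τ) = c B¹_{t₀+c²σ}(u,u)(t₀+c²τ)(x₀ + c·)`
  (`oseenDuhamel_smul_stPull`), whence the Oseen equation passes from `u` to `w`
  (`oseen_smul_stPull`);
* **Steps 2–4 re-threaded** (`knss_rMulNorm_bounded_of_mildBlowupSequence_unit`): the proof of
  `knss_rMulNorm_bounded_of_blowupSequence_unit` (`KNSSTypeIRateProofs`) with the mildness of
  `u` (`KNSS2009_typeI_rate_mild`, at `ν = 1`) transported to the doubly rescaled `w⁽ᵏ⁾`, so that
  the weaker fact `KNSS2009_typeI_rate_mildBlowupSequence` suffices; with the viscosity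
  normalisation `knss_rMulNorm_bounded_of_unit_viscosity` this gives
  `KNSS2009_typeI_rate_rMulNorm_bounded_of_mild : mild → mildBlowupSequence → rMulNorm_bounded`;
* **the glue over mild data** (`KNSS2009_typeI_rate_mildBlowupSequence_of_mildCore :
  mildCompactness → liouville → mildVertex → mildBlowupSequence`, the proof of
  `KNSS2009_typeI_rate_blowupSequence_of_core` verbatim with the Oseen hypothesis threaded), and
  the assembled `KNSS2009_typeI_rate_rMulNorm_bounded_of_mildCore`.

After this file the main step of Theorem 6.2 rests on the mildness clause
(`KNSS2009_typeI_rate_mild`), the Liouville step (`KNSS2009_typeI_rate_liouville`, reduced to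
Theorem 5.1 in `KNSSTypeIRateLiouvilleProofs`), and the compactness and vertex ingredients over
mild data.

## References

* G. Koch, N. Nadirashvili, G. Seregin, V. Šverák, Acta Math. 203 (2009) 83–105 =
  arXiv:0709.3599: §1 (1.2) (scaling), §3 (the kernel), proof of Theorem 6.2, pp. 12–13.
  [KochNadirashviliSereginSverak2009]
* H. Koch, D. Tataru, Adv. Math. 157 (2001), §2 (8). [KochTataruAdvMath2001]
-/

noncomputable section

open MeasureTheory Set Function Filter
open _root_.Topology
open scoped RealInnerProductSpace

namespace Literature.Analysis.FluidPDE

/-! ### Covariance of the Oseen equation under zooming `w(s, y) = c u(t₀ + c²s, x₀ + cy)` -/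

section Zoom

variable {E : Type*} [NormedAddCommGroup E] [InnerProductSpace ℝ E] [FiniteDimensional ℝ E]
  [MeasurableSpace E] [BorelSpace E]
variable {F : Type*} [NormedAddCommGroup F] [NormedSpace ℝ F]

/-- Translation covariance of the caloric extension: `e^{tΔ}(f(x₀ + ·))(y) = (e^{tΔ}f)(x₀ + y)`
(the heat kernel is a convolution kernel). [folklore] -/
theorem heatExtension_comp_add_left (f : E → F) (x₀ : E) (t : ℝ) (y : E) :
    UnboundedOperators.heatExtension (fun z => f (x₀ + z)) t y =
      UnboundedOperators.heatExtension f t (x₀ + y) := by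
  simp only [UnboundedOperators.heatExtension_apply, add_sub_assoc]

/-- Dilation covariance of the caloric extension: `e^{tΔ}(f(c ·))(y) = (e^{c²tΔ}f)(c y)` for
`c, t > 0` (`heatExtension_comp_inv_smul` at `c⁻¹`). [folklore] -/
theorem heatExtension_comp_smul {c : ℝ} (hc : 0 < c) (f : E → F) {t : ℝ} (ht : 0 < t) (y : E) :
    UnboundedOperators.heatExtension (fun z => f (c • z)) t y =
      UnboundedOperators.heatExtension f (c ^ 2 * t) (c • y) := by
  have key := heatExtension_comp_inv_smul (inv_pos.2 hc) f (mul_pos (pow_pos hc 2) ht) y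
  rw [inv_inv, show c⁻¹ ^ 2 * (c ^ 2 * t) = t by field_simp] at key
  exact key

/-- **The caloric term of the zoomed field**: for `w = c • stPull (c²) c t₀ x₀ u`, i.e.
`w(s, y) = c u(t₀ + c²s, x₀ + cy)`, and `T > 0`,
`e^{TΔ}w(σ)(y) = c (e^{c²TΔ}u(t₀ + c²σ))(x₀ + cy)` (KNSS 2009, §1 (1.2): the scaling symmetry). [cite: KochNadirashviliSereginSverak2009, §1 (1.2) (arXiv p. 2)] -/
theorem heatExtension_smul_stPull {c : ℝ} (hc : 0 < c) (t₀ : ℝ) (x₀ : E) (u : ℝ → E → F) (σ : ℝ)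
    {T : ℝ} (hT : 0 < T) (y : E) :
    UnboundedOperators.heatExtension ((c • stPull (c ^ 2) c t₀ x₀ u) σ) T y =
      c • UnboundedOperators.heatExtension (u (t₀ + c ^ 2 * σ)) (c ^ 2 * T) (x₀ + c • y) := by
  have e : (c • stPull (c ^ 2) c t₀ x₀ u) σ = fun z => c • u (t₀ + c ^ 2 * σ) (x₀ + c • z) := by
    funext z; rfl
  rw [e, UnboundedOperators.heatExtension_const_smul,
    heatExtension_comp_smul hc (fun z => u (t₀ + c ^ 2 * σ) (x₀ + z)) hT,
    heatExtension_comp_add_left]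

/-- Affine substitution in the time integral: `∫_{(σ,τ)} g(t₀ + c²ρ) dρ =
(c²)⁻¹ ∫_{(t₀+c²σ, t₀+c²τ)} g(ρ') dρ'` (`σ ≤ τ`, `c ≠ 0`). [folklore] -/
theorem setIntegral_Ioo_comp_add_sq_mul {G : Type*} [NormedAddCommGroup G] [NormedSpace ℝ G]
    (g : ℝ → G) {c : ℝ} (hc : 0 < c) (t₀ : ℝ) {σ τ : ℝ} (hστ : σ ≤ τ) :
    ∫ ρ in Ioo σ τ, g (t₀ + c ^ 2 * ρ) =
      (c ^ 2)⁻¹ • ∫ ρ in Ioo (t₀ + c ^ 2 * σ) (t₀ + c ^ 2 * τ), g ρ := by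
  have hc2 : c ^ 2 ≠ 0 := pow_ne_zero 2 hc.ne'
  have hle : t₀ + c ^ 2 * σ ≤ t₀ + c ^ 2 * τ := by nlinarith [sq_nonneg c]
  rw [← integral_Ioc_eq_integral_Ioo, ← intervalIntegral.integral_of_le hστ,
    ← integral_Ioc_eq_integral_Ioo, ← intervalIntegral.integral_of_le hle,
    intervalIntegral.integral_comp_add_mul (fun ρ => g ρ) hc2 t₀]

/-- **The Duhamel term of the zoomed field**: for `w = c • stPull (c²) c t₀ x₀ u` and `σ ≤ τ`,
`B¹_σ(w, w)(τ)(y) = c B¹_{t₀+c²σ}(u, u)(t₀ + c²τ)(x₀ + cy)` (space substitution `z = x₀ + cy'`,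
time substitution `ρ' = t₀ + c²ρ`, bilinearity, and the homogeneity
`K(c²s, cζ) = c^{−d−1}K(s, ζ)` of the kernel; KNSS 2009, §1 (1.2), §3). No integrability is
needed (the substitution formulas for the Bochner integral are unconditional). [cite: KochNadirashviliSereginSverak2009, §1 (1.2) and §3 (arXiv pp. 2, 6–7)] -/
theorem oseenDuhamel_smul_stPull {c : ℝ} (hc : 0 < c) (t₀ : ℝ) (x₀ : E) (u : ℝ → E → E) {σ τ : ℝ}
    (hστ : σ ≤ τ) (y : E) :
    oseenDuhamel 1 σ (c • stPull (c ^ 2) c t₀ x₀ u) (c • stPull (c ^ 2) c t₀ x₀ u) τ y =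
      c • oseenDuhamel 1 (t₀ + c ^ 2 * σ) u u (t₀ + c ^ 2 * τ) (x₀ + c • y) := by
  set d : ℕ := Module.finrank ℝ E with hd
  have hc0 : c ≠ 0 := hc.ne'
  set X : E := x₀ + c • y with hX
  rw [oseenDuhamel_apply, oseenDuhamel_apply]
  -- the inner integral at time `ρ ∈ (σ, τ)`
  have hinner : ∀ ρ ∈ Ioo σ τ,
      ∫ y', oseenKernel (1 * (τ - ρ)) (y - y') ((c • stPull (c ^ 2) c t₀ x₀ u) ρ y')
        ((c • stPull (c ^ 2) c t₀ x₀ u) ρ y') =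
      c ^ 3 • ∫ z, oseenKernel (1 * (t₀ + c ^ 2 * τ - (t₀ + c ^ 2 * ρ))) (X - z)
        (u (t₀ + c ^ 2 * ρ) z) (u (t₀ + c ^ 2 * ρ) z) := by
    intro ρ hρ
    have hs : 0 < τ - ρ := sub_pos.2 hρ.2
    set v : E → E := u (t₀ + c ^ 2 * ρ) with hv
    -- bilinearity and the substitution `z = x₀ + c y'`
    have e1 : ∀ y', oseenKernel (1 * (τ - ρ)) (y - y') ((c • stPull (c ^ 2) c t₀ x₀ u) ρ y')
        ((c • stPull (c ^ 2) c t₀ x₀ u) ρ y') =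
        (fun z => (c * c) • oseenKernel (τ - ρ) (c⁻¹ • (X - z)) (v z) (v z)) (x₀ + c • y') := by
      intro y'
      have hw : (c • stPull (c ^ 2) c t₀ x₀ u) ρ y' = c • v (x₀ + c • y') := rfl
      have hz : c⁻¹ • (X - (x₀ + c • y')) = y - y' := by
        rw [hX, add_sub_add_left_eq_sub, ← smul_sub, smul_smul, inv_mul_cancel₀ hc0, one_smul]
      simp only [hw, oseenKernel_smul_left, oseenKernel_smul_right, smul_smul, one_mul, hz]
    simp only [e1]
    rw [integral_comp_space_affine hc x₀
      (fun z => (c * c) • oseenKernel (τ - ρ) (c⁻¹ • (X - z)) (v z) (v z)), ← hd]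
    -- homogeneity of the kernel: `K(s, c⁻¹ζ) = c^{d+1} K(c²s, ζ)`
    have e2 : ∀ z, oseenKernel (τ - ρ) (c⁻¹ • (X - z)) (v z) (v z) =
        c ^ (d + 1) • oseenKernel (c ^ 2 * (τ - ρ)) (X - z) (v z) (v z) := fun z => by
      have h := oseenKernel_sq_mul_smul hc hs (c⁻¹ • (X - z)) (v z) (v z)
      rw [smul_inv_smul₀ hc0, ← hd] at h
      rw [h, smul_smul, mul_inv_cancel₀ (pow_ne_zero _ hc0), one_smul]
    simp only [e2, smul_smul, integral_smul]
    rw [show (1 : ℝ) * (t₀ + c ^ 2 * τ - (t₀ + c ^ 2 * ρ)) = c ^ 2 * (τ - ρ) by ring]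
    congr 1
    rw [pow_succ]
    field_simp
  rw [setIntegral_congr_fun measurableSet_Ioo hinner, integral_smul,
    setIntegral_Ioo_comp_add_sq_mul (fun ρ' => ∫ z, oseenKernel (1 * (t₀ + c ^ 2 * τ - ρ')) (X - z)
      (u ρ' z) (u ρ' z)) hc t₀ hστ, smul_smul]
  congr 1
  rw [pow_succ, pow_two]
  field_simp

/-- **The Oseen integral equation is covariant under zooming.** If `u` satisfies
`u(t') = e^{(t'−s')Δ}u(s') − B¹_{s'}(u, u)(t')` pointwise at the times `s' = t₀ + c²σ`,
`t' = t₀ + c²τ` (`σ < τ`, `c > 0`), then `w = c • stPull (c²) c t₀ x₀ u` satisfies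
`w(τ) = e^{(τ−σ)Δ}w(σ) − B¹_σ(w, w)(τ)` pointwise (KNSS 2009, §1 (1.2); used in the proof of
Theorem 6.2, p. 13: the `w⁽ᵏ⁾` "are mild solutions … (for suitable re-scalings of the initial
datum)"). [cite: KochNadirashviliSereginSverak2009, §1 (1.2) and proof of Thm 6.2 (arXiv p. 13)] -/
theorem oseen_smul_stPull {c : ℝ} (hc : 0 < c) (t₀ : ℝ) (x₀ : E) {u : ℝ → E → E} {σ τ : ℝ}
    (hστ : σ < τ)
    (hu : ∀ X, u (t₀ + c ^ 2 * τ) X =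
      UnboundedOperators.heatExtension (u (t₀ + c ^ 2 * σ)) (t₀ + c ^ 2 * τ - (t₀ + c ^ 2 * σ)) X -
        oseenDuhamel 1 (t₀ + c ^ 2 * σ) u u (t₀ + c ^ 2 * τ) X) (y : E) :
    (c • stPull (c ^ 2) c t₀ x₀ u) τ y =
      UnboundedOperators.heatExtension ((c • stPull (c ^ 2) c t₀ x₀ u) σ) (τ - σ) y -
        oseenDuhamel 1 σ (c • stPull (c ^ 2) c t₀ x₀ u) (c • stPull (c ^ 2) c t₀ x₀ u) τ y := by
  rw [heatExtension_smul_stPull hc t₀ x₀ u σ (sub_pos.2 hστ), oseenDuhamel_smul_stPull hc t₀ x₀ u hστ.le,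
    ← smul_sub, show c ^ 2 * (τ - σ) = t₀ + c ^ 2 * τ - (t₀ + c ^ 2 * σ) by ring, ← hu]
  rfl

end Zoom

/-! ### Steps 2–4 re-threaded with the Oseen equation (`ν = 1`) -/

section Unit

variable {T : ℝ} {u : ℝ → (EuclideanSpace ℝ (Fin 3)) → (EuclideanSpace ℝ (Fin 3))} {p : ℝ → (EuclideanSpace ℝ (Fin 3)) → ℝ}

/-- **KNSS 2009, Theorem 6.2, main step from the mildness clause and Steps 5–6 over mild data,
`ν = 1`.** The statement and proof of `knss_rMulNorm_bounded_of_blowupSequence_unit`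
(`KNSSTypeIRateProofs`: Steps 2–4 of the printed proof, arXiv:0709.3599 pp. 12–13) with the
weaker fact `KNSS2009_typeI_rate_mildBlowupSequence`: its extra hypothesis, the Oseen integral
equation of the doubly rescaled `w⁽ᵏ⁾` between all times of `(A_k, B_k)`, is supplied by the
mildness of `u` (`KNSS2009_typeI_rate_mild` at `ν = 1`) transported along the two zooms by
`oseen_smul_stPull` ("Since the functions `w⁽ᵏ⁾` are mild solutions of the Navier–Stokes
equations in `(A_k, 0)` (for suitable re-scalings of the initial datum `u₀`)", p. 13). [cite: KochNadirashviliSereginSverak2009, proof of Thm 6.2 (arXiv pp. 12–13)] -/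
theorem knss_rMulNorm_bounded_of_mildBlowupSequence_unit (hm : KNSS2009_typeI_rate_mild)
    (hd : KNSS2009_typeI_rate_mildBlowupSequence)
    (hT : 0 < T) (h : IsClassicalNSSolutionOn (Ioo 0 T) 1 0 u p)
    (hbdd : ∀ T' < T, ∃ M : ℝ, ∀ t ∈ Ioo 0 T', ∀ x, ‖u t x‖ ≤ M)
    (haxi : ∀ t ∈ Ioo 0 T, IsAxisymmetric (u t))
    {C : ℝ} (hC : 0 < C) (hI : ∀ t ∈ Ioo 0 T, ∀ x, Real.sqrt (T - t) * ‖u t x‖ ≤ C)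
    {C₂ R₀ : ℝ} (hR₀ : 0 < R₀)
    (hdecay : ∀ t ∈ Ioo 0 T, ∀ x, R₀ ≤ cylRadius x → cylRadius x * ‖u t x‖ ≤ C₂) :
    ∃ C' : ℝ, ∀ t ∈ Ioo 0 T, ∀ x, cylRadius x * ‖u t x‖ ≤ C' := by
  -- the Oseen equation of `u` (the mildness clause at `ν = 1`)
  have hmild : ∀ ⦃s t : ℝ⦄, 0 < s → s < t → t < T → ∀ x,
      u t x = UnboundedOperators.heatExtension (u s) (t - s) x - oseenDuhamel 1 s u u t x := by
    intro s t hs hst ht x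
    have := hm one_pos hT h hbdd ⟨C₂, R₀, hR₀, hdecay⟩ hs hst ht x
    rwa [one_mul] at this
  by_contra hunb
  push Not at hunb
  obtain ⟨t, a, lam, M, hseq⟩ := knss_exists_blowup_sequence hT hbdd haxi hdecay hunb
  -- unpack the properties of the blow-up sequence
  have htk : ∀ k, t k ∈ Ioo 0 T := fun k => (hseq k).1
  have htk2 : ∀ k, T / 2 ≤ t k := fun k => (hseq k).2.1
  have hlam : ∀ k, 0 < lam k := fun k => (hseq k).2.2.1
  have hlamR : ∀ k, lam k < R₀ := fun k => (hseq k).2.2.2.1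
  have hMk : ∀ k : ℕ, (k : ℝ) + 1 ≤ M k := fun k => (hseq k).2.2.2.2.1
  have hval : ∀ k, lam k * ‖u (t k) (EuclideanSpace.single 2 (a k) +
      lam k • EuclideanSpace.single 0 1)‖ = M k := fun k => (hseq k).2.2.2.2.2.1
  have hmax : ∀ k, ∀ τ ∈ Ioc 0 (t k), ∀ y, cylRadius y * ‖u τ y‖ ≤ 2 * M k :=
    fun k => (hseq k).2.2.2.2.2.2
  have hMpos : ∀ k, 0 < M k := fun k => by
    have := hMk k
    have : (0 : ℝ) ≤ k := Nat.cast_nonneg k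
    linarith
  have h0 : ∀ k, (EuclideanSpace.single 2 (a k) : (EuclideanSpace ℝ (Fin 3))) 0 = 0 := fun k => by simp
  have h1 : ∀ k, (EuclideanSpace.single 2 (a k) : (EuclideanSpace ℝ (Fin 3))) 1 = 0 := fun k => by simp
  -- the rescaled classical solutions
  have hv : ∀ k, IsClassicalNSSolutionOn ((fun r => T + lam k ^ 2 * r) ⁻¹' Ioo 0 T) 1 0
      (lam k • stPull (lam k ^ 2) (lam k) T (EuclideanSpace.single 2 (a k)) u)
      (lam k ^ 2 • stPull (lam k ^ 2) (lam k) T (EuclideanSpace.single 2 (a k)) p) :=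
    fun k => h.nsRescale_translate_zero (hlam k) T _
  have hw : ∀ k, IsClassicalNSSolutionOn
      (Ioo (-(t k * M k ^ 2 / lam k ^ 2)) ((T - t k) * M k ^ 2 / lam k ^ 2)) 1 0
      ((M k)⁻¹ • stPull ((M k)⁻¹ ^ 2) (M k)⁻¹ ((t k - T) / lam k ^ 2) (EuclideanSpace.single 0 1)
        (lam k • stPull (lam k ^ 2) (lam k) T (EuclideanSpace.single 2 (a k)) u))
      ((M k)⁻¹ ^ 2 • stPull ((M k)⁻¹ ^ 2) (M k)⁻¹ ((t k - T) / lam k ^ 2)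
        (EuclideanSpace.single 0 1)
        (lam k ^ 2 • stPull (lam k ^ 2) (lam k) T (EuclideanSpace.single 2 (a k)) p)) := by
    intro k
    have := (hv k).nsRescale_translate_zero (inv_pos.2 (hMpos k)) ((t k - T) / lam k ^ 2)
      (EuclideanSpace.single 0 1)
    rwa [knss_preimage_preimage_Ioo_eq (hlam k) (hMpos k)] at this
  -- the limits
  have hMlim : Tendsto M atTop atTop :=
    tendsto_atTop_mono hMk (tendsto_atTop_add_const_right _ _ tendsto_natCast_atTop_atTop)
  have hAlim : Tendsto (fun k => -(t k * M k ^ 2 / lam k ^ 2)) atTop atBot :=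
    knss_tendsto_A_atBot hT hR₀ htk2 hlam hlamR hMk
  have hBpos : ∀ k, 0 < (T - t k) * M k ^ 2 / lam k ^ 2 := fun k => by
    have := (htk k).2
    have := hMpos k
    have := hlam k
    exact div_pos (mul_pos (by linarith) (by positivity)) (by positivity)
  have hK : 0 < C + 4 := by linarith
  -- apply the fact
  have hlim := hd hC hK hMpos hMlim hAlim hBpos hw ?_ ?_ ?_ ?_ ?_ ?_
  · -- the contradiction with `‖w k 0 0‖ = 1`
    have hone : ∀ k, ‖((M k)⁻¹ • stPull ((M k)⁻¹ ^ 2) (M k)⁻¹ ((t k - T) / lam k ^ 2)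
        (EuclideanSpace.single 0 1)
        (lam k • stPull (lam k ^ 2) (lam k) T (EuclideanSpace.single 2 (a k)) u)) 0 0‖ = 1 := by
      intro k
      rw [knssW_norm_zero_zero (hMpos k),
        knssV_norm_single (hlam k).le (knss_add_sq_mul_s₀ (hlam k).ne'), hval k,
        inv_mul_cancel₀ (hMpos k).ne']
    have hnorm := hlim.norm
    rw [norm_zero] at hnorm
    have heq : (fun k => ‖((M k)⁻¹ • stPull ((M k)⁻¹ ^ 2) (M k)⁻¹ ((t k - T) / lam k ^ 2)
        (EuclideanSpace.single 0 1)
        (lam k • stPull (lam k ^ 2) (lam k) T (EuclideanSpace.single 2 (a k)) u)) 0 0‖) =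
        fun _ => (1 : ℝ) := funext hone
    rw [heq] at hnorm
    exact one_ne_zero (tendsto_nhds_unique tendsto_const_nhds hnorm)
  · -- the Oseen equation of the `w⁽ᵏ⁾`, transported from `u` along the two zooms
    intro k s s' hs hss' hs' x
    set c : ℝ := (M k)⁻¹ with hc
    set s₀ : ℝ := (t k - T) / lam k ^ 2 with hs₀
    have hcpos : 0 < c := inv_pos.2 (hMpos k)
    -- the corresponding times of `v⁽ᵏ⁾` and of `u`
    have hσ'τ' : s₀ + c ^ 2 * s < s₀ + c ^ 2 * s' := by
      have := mul_lt_mul_of_pos_left hss' (pow_pos hcpos 2); linarith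
    have hmem : ∀ r ∈ Ioo (-(t k * M k ^ 2 / lam k ^ 2)) ((T - t k) * M k ^ 2 / lam k ^ 2),
        T + lam k ^ 2 * (s₀ + c ^ 2 * r) ∈ Ioo 0 T := fun r hr => knss_mem_Ioo_time (hlam k) (hMpos k) hr
    have hsI : s ∈ Ioo (-(t k * M k ^ 2 / lam k ^ 2)) ((T - t k) * M k ^ 2 / lam k ^ 2) :=
      ⟨hs, hss'.trans hs'⟩
    have hs'I : s' ∈ Ioo (-(t k * M k ^ 2 / lam k ^ 2)) ((T - t k) * M k ^ 2 / lam k ^ 2) :=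
      ⟨hs.trans hss', hs'⟩
    have hu'' : ∀ X, u (T + lam k ^ 2 * (s₀ + c ^ 2 * s')) X =
        UnboundedOperators.heatExtension (u (T + lam k ^ 2 * (s₀ + c ^ 2 * s)))
          (T + lam k ^ 2 * (s₀ + c ^ 2 * s') - (T + lam k ^ 2 * (s₀ + c ^ 2 * s))) X -
        oseenDuhamel 1 (T + lam k ^ 2 * (s₀ + c ^ 2 * s)) u u (T + lam k ^ 2 * (s₀ + c ^ 2 * s')) X :=
      fun X => hmild (hmem s hsI).1
        (by have := mul_lt_mul_of_pos_left hσ'τ' (pow_pos (hlam k) 2); linarith) (hmem s' hs'I).2 X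
    have hv'' := fun X => oseen_smul_stPull (hlam k) T (EuclideanSpace.single 2 (a k)) hσ'τ' hu'' X
    exact oseen_smul_stPull hcpos s₀ (EuclideanSpace.single 0 1) hss' hv'' x
  · -- per-`k` bound on `(A_k, 0]`
    intro k
    have hT' : (t k + T) / 2 < T := by linarith [(htk k).2]
    obtain ⟨Mb, hMb⟩ := hbdd _ hT'
    refine ⟨(M k)⁻¹ * (lam k * Mb), fun τ hτ x => knssW_norm_le (hMpos k) (fun y => ?_) x⟩
    refine knssV_norm_le (hlam k).le (fun z => hMb _ ?_ z) y
    have hs := knss_mem_Ioc_time (T := T) (hlam k) (hMpos k) hτ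
    exact ⟨hs.1, by linarith [hs.2, (htk k).2]⟩
  · -- axisymmetry about the axis through `-M_k e₁`
    intro k τ hτ θ x
    refine knssW_axisymmetric_about (hMpos k).ne' ?_ θ x
    exact isAxisymmetric_smul_stPull_of_axis (h0 k) (h1 k)
      (haxi _ (knss_mem_Ioo_time (hlam k) (hMpos k) hτ))
  · -- (wkbound3)
    intro k τ hτ x
    refine knssW_sqrt_neg_mul_norm_le (hMpos k) (knss_s₀_nonpos (htk k).2.le) (fun y => ?_) x
    refine knssV_sqrt_neg_mul_norm_le (hlam k) hI ?_ y
    exact knss_mem_Ioo_time (hlam k) (hMpos k) ⟨hτ.1, lt_of_lt_of_le hτ.2 (hBpos k).le⟩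
  · -- (wkbound), with `4 ≤ C + 4`
    intro k τ hτ x hx
    refine (knssW_norm_le_four_of_cylRadius (hMpos k) (fun y => ?_) hx).trans (by linarith)
    exact knssV_cylRadius_mul_norm_le (h0 k) (h1 k) (hlam k) (hmax k)
      (knss_mem_Ioc_time (hlam k) (hMpos k) hτ) y
  · -- (wkbound2), with `(C + 2) M ≤ (C + 4) M`
    intro k τ hτ x
    refine (knssW_norm_mul_le (C := C) (hMpos k) (knss_s₀_nonpos (htk k).2.le) (fun y => ?_)
      (fun y => ?_) x).trans ?_
    · refine knssV_sqrt_neg_mul_norm_le (hlam k) hI ?_ y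
      have hs := knss_mem_Ioc_time (T := T) (hlam k) (hMpos k) hτ
      exact ⟨hs.1, lt_of_le_of_lt hs.2 (htk k).2⟩
    · exact knssV_cylRadius_mul_norm_le (h0 k) (h1 k) (hlam k) (hmax k)
        (knss_mem_Ioc_time (hlam k) (hMpos k) hτ) y
    · have := hMpos k
      nlinarith

end Unit

/-! ### The assembled reductions -/

section Assembly

/-- **The main step of Theorem 6.2 from the mildness clause and Steps 5–6 over mild data**
(Steps 2–4 re-threaded, `knss_rMulNorm_bounded_of_mildBlowupSequence_unit`; viscosity normalised
by `knss_rMulNorm_bounded_of_unit_viscosity` of `KNSSTypeIRateProofs`). [cite: KochNadirashviliSereginSverak2009, proof of Thm 6.2 (arXiv pp. 12–13)] -/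
theorem KNSS2009_typeI_rate_rMulNorm_bounded_of_mild (hm : KNSS2009_typeI_rate_mild)
    (hd : KNSS2009_typeI_rate_mildBlowupSequence) : KNSS2009_typeI_rate_rMulNorm_bounded := by
  refine knss_rMulNorm_bounded_of_unit_viscosity
    fun T u p hT h hbdd haxi C hC hI C₂ R₀ hR₀ hdecay => ?_
  exact knss_rMulNorm_bounded_of_mildBlowupSequence_unit hm hd hT h hbdd haxi hC hI hR₀ hdecay

/-- **Steps 5–6 over mild data from their three ingredients** (the proof of
`KNSS2009_typeI_rate_blowupSequence_of_core`, `KNSSTypeIRateCoreProofs`, verbatim with the Oseen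
hypothesis threaded): compactness over mild data, the Liouville step and the vertex estimate
over mild data imply `KNSS2009_typeI_rate_mildBlowupSequence`. [cite: KochNadirashviliSereginSverak2009, proof of Thm 6.2 (arXiv p. 13)] -/
theorem KNSS2009_typeI_rate_mildBlowupSequence_of_mildCore
    (h1 : KNSS2009_typeI_rate_mildCompactness) (h2 : KNSS2009_typeI_rate_liouville)
    (h3 : KNSS2009_typeI_rate_mildVertex) : KNSS2009_typeI_rate_mildBlowupSequence := by
  intro C K M A B w q hC hK hMpos hMlim hAlim hBpos hw hmild hL hsym hI hoff hmul
  refine tendsto_of_subseq_tendsto fun ψ hψ => ?_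
  -- compactness along `ψ`
  obtain ⟨φ, W, hφ, hWc, hWdiv, hWdec, hWmild, hWconv⟩ :=
    h1 hC hK (fun k => hMpos (ψ k)) (hMlim.comp hψ) (hAlim.comp hψ) (fun k => hBpos (ψ k))
      (fun k => hw (ψ k)) (fun k => hmild (ψ k)) (fun k => hL (ψ k)) (fun k => hI (ψ k))
      (fun k => hmul (ψ k))
  have hφt : Tendsto φ atTop atTop := hφ.tendsto_atTop
  have hθ : Tendsto (fun k => ψ (φ k)) atTop atTop := hψ.comp hφt
  have hθM : Tendsto (fun k => M (ψ (φ k))) atTop atTop := hMlim.comp hθ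
  have hθA : Tendsto (fun k => A (ψ (φ k))) atTop atBot := hAlim.comp hθ
  -- continuity of the slices of `W`
  have hWcont : ∀ t < 0, Continuous (W t) := fun t ht =>
    hWc.comp_continuous (continuous_const.prodMk continuous_id) fun x => ⟨ht, mem_univ x⟩
  -- pointwise convergence of the slices along `ψ ∘ φ`
  have hpt : ∀ t < 0, ∀ x, Tendsto (fun k => w (ψ (φ k)) t x) atTop (𝓝 (W t x)) :=
    fun t ht x => (tendstoLocallyUniformlyOn_univ.2 (hWconv t ht)).tendsto_at (mem_univ x)
  -- `W` is bounded by `K` (the cylinders recede)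
  have hWbdd : ∃ K' : ℝ, ∀ t < 0, ∀ x, ‖W t x‖ ≤ K' := by
    refine ⟨K, fun t ht x => le_of_tendsto (hpt t ht x).norm ?_⟩
    filter_upwards [hθA.eventually_lt_atBot t, eventually_lt_cylRadius_sub hθM x] with k hk1 hk2
    exact hoff (ψ (φ k)) t ⟨hk1, ht.le⟩ x hk2
  -- `W` is independent of `x₂`
  have hWx2 : ∀ t < 0, ∀ (x : EuclideanSpace ℝ (Fin 3)) (δ : ℝ),
      W t (x + EuclideanSpace.single 1 δ) = W t x := by
    intro t ht x δ
    obtain ⟨k₀, hk₀⟩ := eventually_atTop.1 (hθA.eventually_lt_atBot t)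
    have hconv' : TendstoLocallyUniformly (fun k => w (ψ (φ (k + k₀))) t) (W t) atTop :=
      tendstoLocallyUniformly_comp_of_tendsto (hWconv t ht) (tendsto_add_atTop_nat k₀)
    refine eq_of_tendstoLocallyUniformly_of_rot_about (M := fun k => M (ψ (φ (k + k₀))))
      (hθM.comp (tendsto_add_atTop_nat k₀)) (fun k θ' y => ?_) hconv' (hWcont t ht) x δ
    exact hsym (ψ (φ (k + k₀))) t ⟨hk₀ _ (Nat.le_add_left _ _), ht.trans (hBpos _)⟩ θ' y
  -- hence `W = 0`
  have hW0 : ∀ t < 0, ∀ x, W t x = 0 := h2 hWc hWbdd hWdiv hWmild hWx2 hWdec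
  -- the vertex estimate along `ψ`
  have hV := h3 hC hK (fun k => hMpos (ψ k)) (hMlim.comp hψ) (hAlim.comp hψ)
    (fun k => hBpos (ψ k)) (fun k => hw (ψ k)) (fun k => hmild (ψ k)) (fun k => hL (ψ k))
    (fun k => hI (ψ k)) (fun k => hoff (ψ k)) (fun k => hmul (ψ k))
  -- conclusion along `ψ ∘ φ`
  refine ⟨φ, Metric.tendsto_nhds.2 fun ε hε => ?_⟩
  obtain ⟨δ, hδ, hev⟩ := hV (ε / 3) (by positivity)
  have hp : Tendsto (fun k => w (ψ (φ k)) (-δ) 0) atTop (𝓝 0) := by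
    have := hpt (-δ) (by linarith) 0
    rwa [hW0 _ (by linarith)] at this
  have e3 : ∀ᶠ k in atTop, ‖w (ψ (φ k)) (-δ) 0‖ < ε / 3 := by
    have := Metric.tendsto_nhds.1 hp (ε / 3) (by positivity)
    simpa only [dist_zero_right] using this
  have e4 : ∀ᶠ k in atTop, ∀ τ ∈ Icc (-δ) 0, ‖w (ψ (φ k)) 0 0 - w (ψ (φ k)) τ 0‖ ≤ ε / 3 :=
    hφt.eventually hev
  filter_upwards [e3, e4] with k hk3 hk4
  rw [dist_zero_right]
  have h5 := hk4 (-δ) ⟨le_rfl, by linarith⟩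
  calc ‖w (ψ (φ k)) 0 0‖
      = ‖(w (ψ (φ k)) 0 0 - w (ψ (φ k)) (-δ) 0) + w (ψ (φ k)) (-δ) 0‖ := by rw [sub_add_cancel]
    _ ≤ ‖w (ψ (φ k)) 0 0 - w (ψ (φ k)) (-δ) 0‖ + ‖w (ψ (φ k)) (-δ) 0‖ := norm_add_le _ _
    _ < ε := by linarith

/-- **KNSS 2009, Theorem 6.2, main step, from the mildness clause, compactness and the vertex
estimate over mild data, and the Liouville step** (three layers of decomposition assembled:
`KNSSTypeIRate`, `KNSSTypeIRateCore`, `KNSSTypeIRateMild`; everything else in Steps 1–6 of the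
printed proof is proved in the tree). With `KNSS2009_typeI_rate_liouville_of_planar`
(`KNSSTypeIRateLiouvilleProofs`) the Liouville step is in turn Theorem 5.1. [cite: KochNadirashviliSereginSverak2009, Thm 6.2 and its proof (arXiv pp. 12–13)] -/
theorem KNSS2009_typeI_rate_rMulNorm_bounded_of_mildCore (hm : KNSS2009_typeI_rate_mild)
    (h1 : KNSS2009_typeI_rate_mildCompactness) (h2 : KNSS2009_typeI_rate_liouville)
    (h3 : KNSS2009_typeI_rate_mildVertex) : KNSS2009_typeI_rate_rMulNorm_bounded :=
  KNSS2009_typeI_rate_rMulNorm_bounded_of_mild hm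
    (KNSS2009_typeI_rate_mildBlowupSequence_of_mildCore h1 h2 h3)

/-- **KNSS 2009, Theorem 6.2 as vendored, from Theorem 6.1, the mildness clause, and the three
ingredients of Steps 5–6 over mild data.** [cite: KochNadirashviliSereginSverak2009, Thm 6.2 and its proof (arXiv pp. 12–13)] -/
theorem KNSS2009_regularity_typeI_rate_of_mildCore (h61 : KNSS2009_regularity_bound_C_over_r)
    (hm : KNSS2009_typeI_rate_mild) (h1 : KNSS2009_typeI_rate_mildCompactness)
    (h2 : KNSS2009_typeI_rate_liouville) (h3 : KNSS2009_typeI_rate_mildVertex) :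
    KNSS2009_regularity_typeI_rate :=
  KNSS2009_regularity_typeI_rate_of_parts h61
    (KNSS2009_typeI_rate_rMulNorm_bounded_of_mildCore hm h1 h2 h3)

end Assembly

end Literature.Analysis.FluidPDE

end
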